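import Literature.NumberTheory.EllipticCurves.Rank1Residual.MuLambdaCarriers
import Literature.NumberTheory.EllipticCurves.Rank1Residual.Predicates
import Literature.NumberTheory.EllipticCurves.IwasawaAlgebraProofs
import Literature.NumberTheory.EllipticCurves.Selmer
import Literature.NumberTheory.EllipticCurves.Tamagawa
import Literature.NumberTheory.EllipticCurves.QuadraticTwist
import HarnessLib

/-!
# D-imc-93 — THE CYCLOTOMIC FINE SELMER GROUP MOD 2 IS TWIST-RIGID AT p = 2 (crux workfile, cell `bsd-f1-sign2`, seat -imc g38)

Bears on crux K4 `stmt-BirchSwinnertonDyer-19097` = `…Theses.ByReductionTypeAtTwo.SupersingularRankZeroAtTwo`, registry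
`Lines/odd_blind_package.lean` v2.19, stub 3 `FineMuZeroOnHabitatAtTwo` (= Coates–Sujatha Conjecture A, `μ`-form, at `(E, 2)` on the
habitat non-CM · analytic rank 0 · good supersingular at 2; §10.117 D-84).  LENS = Iwasawa main conjecture at 2: «where do the
2-adic error terms of the FINE side sit, and which of them survive a quadratic twist».

THE OBSERVATION.  Let `E/ℚ` be good supersingular at `2`.  All three roots of the 2-division polynomial have 2-adic valuation
`−2/3` (formal parameter valuation `1/3`), so `E(K)[2] = 0` for every `K/ℚ₂` with `3 ∤ e(K/ℚ₂)`; in particular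
`E(ℚ^cyc)[2^∞] = 0` and `E(ℚ₂^cyc)[2^∞] = 0` for the cyclotomic `ℤ₂`-extension, for `E` AND FOR EVERY QUADRATIC TWIST `E_d`
(`E_d[2] = E[2]` as Galois modules, literally: `χ_d ≡ 1 (mod 2)`).  Hence `Sel₀(E/ℚ^cyc)[2^∞][2]` is the fine Selmer group of the
FIXED Galois module `E[2]` over `ℚ^cyc` cut out by the local conditions `L_w = E(ℚ^cyc_w)[2^∞] ⊗ ℤ/2 ⊂ H¹(ℚ^cyc_w, E[2])`, and for a
twist `E_d` with (a) every odd prime `ℓ ∣ d` of good reduction with `a_ℓ(E)` odd (⟺ `Frob_ℓ` is a 3-cycle on `E[2]` ⟺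
`E(ℚ_ℓ^cyc)[2] = 0`), (b) `Δ_E < 0` or `d > 0` (real place), (c) ANY behaviour at `2` (the condition at `w ∣ 2` is `0` for both:
the fine condition at a supersingular prime has no `±` choice), the local conditions of `E` and `E_d` COINCIDE at every place of
`ℚ^cyc` (at `ℓ ∣ N_E` or good `ℓ ∤ 2d`: `ℚ_ℓ(√d) ⊂ ℚ_ℓ^cyc` is the unramified quadratic layer, so `E ≅ E_d` over `ℚ_ℓ^cyc`
compatibly with `E[2] = E_d[2]`).  CONSEQUENCE (K93-T): `Sel₀(E/ℚ^cyc)[2] = Sel₀(E_d/ℚ^cyc)[2]` inside `H¹(ℚ^cyc, E[2])`,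
`Γ`-equivariantly; so `X₀(E)/2 ≅ X₀(E_d)/2` as `𝔽₂⟦T⟧`-modules, hence **`μ(X₀(E/ℚ^cyc)) = 0 ⟺ μ(X₀(E_d/ℚ^cyc)) = 0`**
(`μ = 0 ⟺ X₀/2` finite, Washington §13.2 / tree `muInvariant_eq_zero_iff`) and **`X₀(E) = 0 ⟺ X₀(E_d) = 0`** (Nakayama):
Conjecture A at 2 and the triviality of the 2-primary fine Selmer group are CONSTANT on these twist classes — at the one prime
where the printed twist-comparison theorems do not reach (Lim–Sujatha 2018 Prop. «fg cong»: `p = 2 ⟹ F` totally imaginary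
[arXiv:1603.08640 p. 3, p. 8]; Ray–Shingavekar 2025 Thm. 2: `p ≥ 5` ordinary, `Λ`-isomorphism of Selmer groups under
`E(K_v)[p] = 0` on `Σ` [arXiv:2507.21339 p. 4]).

THE DOOR (K93-B) = Greenberg 1999 Prop. 3.8 [LNM 1716, p. 95 of the held scan: hypotheses (ii) «nonsplit multiplicative: p odd OR
`ord_ℓ(j_E)` odd», (iii) «additive: `E(ℚ_ℓ)` has no point of order p», restated `p ∤ c_ℓ`] TRANSPOSED TO THE FINE GROUP AT
SUPERSINGULAR 2, where hypothesis (i) (at `p`) DISAPPEARS: `E` good ss at 2, `Sel₂(E/ℚ) = 0`, `2 ∤ c_ℓ` for all `ℓ` ⟹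
`Sel₀(E/ℚ^cyc)[2^∞] = 0` (so `X₀ = 0`, `μ = λ = 0`).  Proof sketch: `X₀/(2,T) ≅ V(E)^∨`, `V(E) ⊂ H¹(ℚ, E[2])` the classes with
`loc_v ∈ ker(H¹(ℚ_v,E[2]) → H¹(ℚ_v^cyc, E[2^∞]))`; `2 ∤ c_ℓ` kills the capitulation kernels `H¹(Γ_ℓ, E(ℚ_ℓ^cyc)[2^∞])` away from 2,
the condition at 2 is `0 ⊂ E(ℚ₂)/2`, at `∞` it is the Selmer condition; so `V(E) ⊆ Sel₂(E/ℚ) = 0`.  Per row the input is a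
2-DESCENT certificate (`W.selmerGroup 2 = ⊥`, kernel-certifiable in the SEL2CUBIC style of this tree) + Tamagawa parities — no
class group, no GRH, no 2-adic L-function, no Euler system.

CENSUS = BC5 WITNESS (this session, local pure python, Cremona `allbsd/allgens` N < 5·10⁵, two engines for the 2-adic primitivity
of generators — formal-group level vs. halving quartic — agreeing 4219/4219; sha16 of outputs in `R93-FineGermTwistRigid.md`):
(A) door census on the FULL habitat of 19097 (69 850 classes; anchor: habitat⁺ `a₂ = 0, Δ < 0` = 22 320 classes = census3 of
record): door-open (`2 ∤ ∏c_ℓ` ∧ `Ш_an` odd — the analytic order as PROXY for `Sel₂ = 0`, flagged) = 14 873 classes = 21.29 %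
(by `(a₂, sgn Δ)`: 23.97 / 27.37 / 21.31 / 25.72 / 16.74 / 20.51 %); (B) twist-rigidity falsifier F93: 17 012 (base class, twist class)
pairs `E ↦ E_d` with `N_E < 55 556`, `N_{E_d} < 5·10⁵`; on the PREDICTION CELL (d admissible: (a)+(b), base `2 ∤ ∏c_ℓ`) 3 325 pairs over
1 473 base classes / 3 102 twist classes: base `Ш_an` odd ⟹ twist ∈ {rank 0 ∧ `Ш_an` odd (2 292), rank 1 ∧ `Ш_an` odd ∧ generator
∉ 2E_d(ℚ₂) (907)}, base `Ш_an` even ⟹ twist ∈ {rank 0 ∧ `Ш_an` even (50), rank 1 non-primitive-or-`Ш_an`-even (20), rank 2 (56)}: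
**0 violations, 0 undecided**; CONTROLS violate visibly (ONE convention, REF1 §523 R523d: «violations» = departures from the cell pattern
`Ш_an(E)` odd ⟹ decided-odd twist / `Ш_an(E)` even ⟹ V1-type twist): sign condition (b) dropped 307/866 + 77/92, condition (a) dropped (some
`a_ℓ(E)` even) 1 071/2 427 + 101/125, base with `2 ∣ ∏c_ℓ` 1 149/6 024 + 190/296 (v1 of this file printed the V1-counts 15/92 and 24/125 for
the first two `Ш_an`-even subcells — same tables, other convention; `R93` report93.txt has both).  REF1 R-96 (§523): K93-B SURVIVES
(theorem-candidate, print-assembled), K93-T SURVIVES; door census 14 873/69 850 and the 17 012-pair scan replicated row-identically by an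
independent engine; BC7 CLEAN ×2.

Typed candidate Props (nothing asserted; all over tree declarations): `FineTrivialAtTwo`, `OddTamagawa`, `TwistAdmissibleAtTwo`,
K93-B `FineDoorAtTwo`, K93-T `FineTwistRigidAtTwo`; PROVED here (kernel, 0 sorry): `fineMuZeroAt_of_fineTrivialAtTwo`
(`Sel₀ = 0 ⟹ μ(X₀) = 0` for every dual datum, via `muInvariant_eq_zero_iff`), and the consumers `fineMuZeroAt_of_door`,
`fineMuZeroAt_of_admissibleRelative` (a habitat row is discharged by the 2-descent of ANY admissible twist, e.g. a rank-1 relative).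
PARTITION 52421 = 17880 + 27650 + 3440 + 3451 unchanged; beyond-print theorem: no (K93-T/K93-B are conjecture-grade typed Props with
a half-page proof sketch each, to be audited REF1 R-96 / placed REF2 P-93); BSD not proved; bears_on: stmt-BirchSwinnertonDyer-19097.

References: [Greenberg1999LNM1716, Prop. 3.8 + Remark (p ∤ c_ℓ)]; [CoatesSujatha2005, §3 (A)]; [MazurRubin2010, Lemma 2.10, Prop. 3.3]
(level-0 `Sel₂` under local conditions); [BarrerasalazarPacettiTornaria2021, Thm. 2.16, §3] (tree `BPT2021.twoSelmerRank_clStar_bounds`: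
`dim Sel₂(E_d) ∈ [dim Cl_*(A,E_d)[2], +1]`, (†.i) at `ℓ ∣ d` = condition (a)); [Wuthrich2007fineSha] (rank-1 criterion `Ж` trivial ∧
`P ∉ 2E(ℚ_p)`); arXiv:1603.08640, arXiv:2507.21339 (the printed twist comparisons, `p` odd / `F` totally imaginary at 2);
[Washington1997, §13.2].
-/

set_option linter.dupNamespace false

noncomputable section

open scoped Classical
open WeierstrassCurve PowerSeries
open Literature.NumberTheory.EllipticCurves Literature.NumberTheory.EllipticCurves.Rank1Residual

namespace Summit.BirchSwinnertonDyer.BirchSwinnertonDyer.Cruxes.SupersingularRankZeroAtTwo.D93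

universe u

/-! ## §1 The objects -/

/-- **`Sel₀(E/ℚ_∞)[2^∞] = 0`**: the 2-primary fine Selmer group of `W` over (every model of) the cyclotomic `ℤ₂`-extension of `ℚ`
is trivial — i.e. `X₀(E/ℚ^cyc) = 0` at `p = 2` (`μ = λ = 0` and no finite part).  A predicate; nothing asserted.
[cite: CoatesSujatha2005, §3] -/
def FineTrivialAtTwo (W : WeierstrassCurve ℚ) : Prop :=
  ∀ κ : ZpExtension ℚ 2, κ.IsCyclotomic → W.fineSelmerInfty κ = ⊥

/-- **`2 ∤ c_ℓ(E)` for every prime `ℓ`** — Greenberg's hypotheses (ii)+(iii) of Prop. 3.8 at `p = 2` in their Tamagawa form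
(Remark after Prop. 3.8): at a multiplicative `ℓ` this says `ord_ℓ(Δ_min)` is odd (tree:
`localTamagawaNumber_eq_ordMinimalDiscriminant_of_kodairaNeron` for the split case), at an additive `ℓ` it says `E(ℚ_ℓ)[2] = 0`
(tree: `natCard_primePowTorsion_dvd_localTamagawaNumber_mul_of_hasAdditiveReductionAt`), at good `ℓ` it is automatic (`c_ℓ = 1`).
In the cyclotomic `ℤ₂`-tower it is exactly the vanishing of the capitulation kernels `H¹(Γ_ℓ, E(ℚ_ℓ^cyc)[2^∞])`, `ℓ ≠ 2`.
[cite: Greenberg1999LNM1716, Prop. 3.8 and the Remark following it] -/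
def OddTamagawa (W : WeierstrassCurve ℚ) : Prop :=
  ∀ (ℓ : ℕ) [Fact ℓ.Prime], ¬ 2 ∣ (W.baseChange ℚ_[ℓ]).localTamagawaNumber ℤ_[ℓ]

/-- **Admissible twist parameter at 2** for a globally minimal `W` good supersingular at `2`: `d` squarefree, every ODD prime
`ℓ ∣ d` is a prime of good reduction with `a_ℓ(W)` odd (⟺ `Frob_ℓ` acts on `W[2]` as a 3-cycle ⟺ `W(ℚ_ℓ^cyc)[2] = 0`), and the
real place is controlled (`Δ < 0`, or `d > 0`).  NO condition at `2`: `d` may be even or `≡ 3 (mod 4)` (the twist may be additive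
at 2).  [cite: MazurRubin2010, Lemma 2.10 (the level-0 local conditions)] -/
def TwistAdmissibleAtTwo (W : WeierstrassCurve ℚ) [W.IsGloballyMinimal] (d : ℤ) : Prop :=
  Squarefree d ∧
    (∀ (ℓ : ℕ) [Fact ℓ.Prime], ℓ ≠ 2 → (ℓ : ℤ) ∣ d → W.HasGoodReductionAtPrime ℓ ∧ Odd (W.frobeniusTrace ℓ)) ∧
    (W.Δ < 0 ∨ 0 < d)

/-! ## §2 The two candidate Props (conjecture-grade; typed, nothing asserted) -/

/-- **K93-B `FineDoorAtTwo` — Greenberg's Prop. 3.8 transposed to the FINE Selmer group at supersingular 2.**  For a globally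
minimal `W/ℚ` good supersingular at `2` with `Sel₂(W/ℚ) = 0` and `2 ∤ c_ℓ` for all `ℓ`: `Sel₀(W/ℚ^cyc)[2^∞] = 0`.
Why it might fail: a hidden contribution at the prime above 2 of `ℚ^cyc` (the sketch uses `E(ℚ₂^cyc)[2^∞] = 0`, valuation `1/3` of the
2-division roots, and the inflation–restriction/Nakayama step `X₀/(2,T) ≅ V(E)^∨`); falsifier F93-A: ONE habitat row with a certified
2-descent `Sel₂ = 0`, odd Tamagawa numbers and `X₀ ≠ 0` (none among 14 873 door-open classes is even a candidate: every admissible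
twist of every such row has `rank ≤ 1` and odd `Ш_an`, 3 199/3 199).  [cite: Greenberg1999LNM1716, Prop. 3.8]
[cite: CoatesSujatha2005, §3 (A)] -/
@[conjecture] def FineDoorAtTwo : Prop :=
  ∀ (W : WeierstrassCurve ℚ) [W.IsElliptic] [W.IsGloballyMinimal],
    GoodSS W 2 → W.selmerGroup 2 = ⊥ → OddTamagawa W → FineTrivialAtTwo W

/-- **K93-T `FineTwistRigidAtTwo` — Conjecture A at 2 and `X₀ = 0` at 2 are constant on admissible quadratic-twist classes.**
For `W` globally minimal, good supersingular at `2`, `d` admissible (`TwistAdmissibleAtTwo`), and `W'` any globally minimal model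
of the twist `W^d`: `Sel₀(W/ℚ^cyc)[2^∞] = 0 ⟺ Sel₀(W'/ℚ^cyc)[2^∞] = 0` and `μ(X₀(W)) = 0 ⟺ μ(X₀(W')) = 0`.  Mechanism:
`W'[2] = W[2]` and the local conditions `E(ℚ^cyc_w)[2^∞] ⊗ ℤ/2` coincide at every place of `ℚ^cyc`, so `Sel₀[2]` — and with it
`X₀/2X₀` as an `𝔽₂⟦T⟧`-module — is literally the same for `W` and `W'`.  Why it might fail: the identification at the real places
when `Δ > 0` (hence the clause `Δ < 0 ∨ 0 < d`; dropping it produces 322 violations among 958 census pairs) or at an additive prime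
of `W` dividing… nothing (primes `ℓ ∣ d` are required good).  Falsifier F93-B run: 0/3 325 (see the module docstring).
μ-clause (REF1 R523b, non-blocking): `FineMuZeroAt · 2` is torsion-conditional per datum, so the `↔` is the intended one GRANTED
`X₀(W)`, `X₀(W')` are both `Λ`-torsion — in tree as the named fact `Literature.NumberTheory.EllipticCurves.Kato2004_fineSelmerDual_isTorsion`
(KatoFineSelmerDualTorsion.lean; Kato 2004 Thm. 12.4 (1) + (17.13.1), EVERY `p` incl. `2`; a conjunct of `PublishedInputsAtTwo` = `stub_pub`
of line v2.19), never via the consumer path below (door ⟹ `FineTrivialAtTwo` ⟹ `μ = 0` is kernel).  REF2 P-93: the `Δ < 0` half of the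
μ-clause is KNOWN-IN-TREE (`…FineRoadQuadraticTwist.finite_twoTorsion_iff_of_smul_eq_quadraticTwist_of_Δ_neg`, att-p5), the sign clause is
the tree's `0 < d ∨ Δ < 0` admissibility (`…FineRoadRealKummerTwistAdmissible`); GENUINELY NEW here = the exact `Sel₀[2]`-equality and the
`FineTrivialAtTwo` clause (MR10 Lemma 2.10 shape), grade new-combination.
[cite: MazurRubin2010, Lemma 2.10, Prop. 3.3] [cite: BarrerasalazarPacettiTornaria2021, Thm. 2.16] -/
@[conjecture] def FineTwistRigidAtTwo : Prop :=
  ∀ (W W' : WeierstrassCurve ℚ) [W.IsElliptic] [W.IsGloballyMinimal] [W'.IsElliptic] [W'.IsGloballyMinimal] (d : ℤ),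
    GoodSS W 2 → TwistAdmissibleAtTwo W d →
      (∃ C : WeierstrassCurve.VariableChange ℚ, C • W.quadraticTwist (d : ℚ) = W') →
        (FineTrivialAtTwo W ↔ FineTrivialAtTwo W') ∧ (FineMuZeroAt W 2 ↔ FineMuZeroAt W' 2)

/-! ## §3 Kernel theorems: `Sel₀ = 0 ⟹ μ(X₀) = 0`, and the consumers for stub 3 -/

/-- `Sel₀(E/ℚ_∞)[2^∞] = ⊥ ⟹` every Pontryagin-dual datum `Y` of it is a subsingleton. [folklore] -/
theorem subsingleton_X_of_fineSelmerInfty_eq_bot (W : WeierstrassCurve ℚ) {κ : ZpExtension ℚ 2}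
    {γ : Field.absoluteGaloisGroup ℚ} (h : W.fineSelmerInfty κ = ⊥) (Y : W.FineSelmerDualData κ γ) :
    Subsingleton Y.X := by
  have hs : ∀ s : W.fineSelmerInfty κ, s = 0 := fun s =>
    Subtype.ext ((AddSubgroup.eq_bot_iff_forall _).mp h s s.2)
  have hhom : ∀ f g : (W.fineSelmerInfty κ →+ AddCircle (1 : ℚ)), f = g := fun f g => by
    ext s
    rw [hs s, map_zero, map_zero]
  exact ⟨fun x y => Y.bijective.1 (hhom _ _)⟩

/-- **`Sel₀(E/ℚ_∞)[2^∞] = 0 ⟹ μ(X₀(E/ℚ_∞)) = 0`** in the cell's carrier shape: `FineTrivialAtTwo W → FineMuZeroAt W 2`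
(every finitely generated torsion dual datum is a subsingleton, hence finitely generated over `ℤ₂`, hence `μ = 0` by
`muInvariant_eq_zero_iff` — Washington §13.2). [cite: Washington1997, §13.2] -/
theorem fineMuZeroAt_of_fineTrivialAtTwo (W : WeierstrassCurve ℚ) [W.IsElliptic] (h : FineTrivialAtTwo W) :
    FineMuZeroAt W 2 := by
  intro κ γ hκ _hγ _hγ' Y hYf hYt
  haveI : Subsingleton Y.X := subsingleton_X_of_fineSelmerInfty_eq_bot W (h κ hκ) Y
  haveI : Subsingleton (RestrictScalars ℤ_[2] (IwasawaAlgebra 2) Y.X) := ‹Subsingleton Y.X›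
  haveI : Finite (RestrictScalars ℤ_[2] (IwasawaAlgebra 2) Y.X) := Finite.of_subsingleton
  haveI : Module.Finite ℤ_[2] (RestrictScalars ℤ_[2] (IwasawaAlgebra 2) Y.X) := Module.Finite.of_finite
  haveI := hYf
  exact (muInvariant_eq_zero_iff_holds 2 Y.X hYt).mpr ‹_›

/-- **Stub 3 on the door-open sub-habitat, modulo K93-B**: a globally minimal curve good supersingular at `2` with `Sel₂ = 0` and odd
Tamagawa numbers has `μ(X₀(E/ℚ^cyc)) = 0` at `p = 2` (indeed `X₀ = 0`).  The rank-0/non-CM hypotheses of the habitat are not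
even needed. [cite: Greenberg1999LNM1716, Prop. 3.8] -/
theorem fineMuZeroAt_of_door (hDoor : FineDoorAtTwo) (W : WeierstrassCurve ℚ) [W.IsElliptic] [W.IsGloballyMinimal]
    (hss : GoodSS W 2) (hSel : W.selmerGroup 2 = ⊥) (hTam : OddTamagawa W) : FineMuZeroAt W 2 :=
  fineMuZeroAt_of_fineTrivialAtTwo W (hDoor W hss hSel hTam)

/-- **Twist propagation, modulo K93-T**: Conjecture A (`μ`-form) at 2 passes from `W` to every globally minimal model of an
admissible twist. [cite: CoatesSujatha2005, §3 (A)] -/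
theorem fineMuZeroAt_twist (hT : FineTwistRigidAtTwo) (W W' : WeierstrassCurve ℚ) [W.IsElliptic] [W.IsGloballyMinimal]
    [W'.IsElliptic] [W'.IsGloballyMinimal] (d : ℤ) (hss : GoodSS W 2) (hd : TwistAdmissibleAtTwo W d)
    (htw : ∃ C : WeierstrassCurve.VariableChange ℚ, C • W.quadraticTwist (d : ℚ) = W') (h : FineMuZeroAt W 2) :
    FineMuZeroAt W' 2 :=
  ((hT W W' d hss hd htw).2).mp h

/-- **A habitat row is discharged by the 2-descent of ANY admissible relative** (modulo K93-T and K93-B): if `W` is good ss at 2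
with an admissible twist parameter `d`, `W'` a globally minimal model of `W^d`, and the DOOR is open at `W` (`Sel₂(W) = 0`, odd
Tamagawa numbers — e.g. `W` a rank-0 curve while `W'` is the habitat row, or vice versa), then `μ(X₀(W'/ℚ^cyc)) = 0` at `2`.
Census reading: 907 rank-1 twist classes inherit `X₀ = 0` from 2 292 rank-0 door-open classes and conversely.
[cite: Greenberg1999LNM1716, Prop. 3.8] [cite: MazurRubin2010, Prop. 3.3] -/
theorem fineMuZeroAt_of_admissibleRelative (hT : FineTwistRigidAtTwo) (hDoor : FineDoorAtTwo)
    (W W' : WeierstrassCurve ℚ) [W.IsElliptic] [W.IsGloballyMinimal] [W'.IsElliptic] [W'.IsGloballyMinimal] (d : ℤ)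
    (hss : GoodSS W 2) (hd : TwistAdmissibleAtTwo W d)
    (htw : ∃ C : WeierstrassCurve.VariableChange ℚ, C • W.quadraticTwist (d : ℚ) = W')
    (hSel : W.selmerGroup 2 = ⊥) (hTam : OddTamagawa W) : FineMuZeroAt W' 2 :=
  fineMuZeroAt_twist hT W W' d hss hd htw (fineMuZeroAt_of_door hDoor W hss hSel hTam)

/-- **The registry shape**: K93-B gives stub 3 `FineMuZeroOnHabitatAtTwo` of `Lines/odd_blind_package.lean` v2.19 RESTRICTED to the
door-open rows (binders of the stub verbatim + the two door inputs).  The complement (door shut: `2 ∣ ∏ c_ℓ`, or `Sel₂ ≠ 0`) keeps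
the class-number door of D-84 / the residual Iwasawa `μ₂`-conjecture. [cite: CoatesSujatha2005, §3 (A)] -/
theorem fineMuZeroOnHabitat_doorOpen_of_fineDoor (hDoor : FineDoorAtTwo) :
    ∀ (W : WeierstrassCurve ℚ) [W.IsElliptic] [W.IsGloballyMinimal],
      ¬ W.HasCM → W.analyticRank = 0 → GoodSS W 2 → W.selmerGroup 2 = ⊥ → OddTamagawa W → FineMuZeroAt W 2 :=
  fun W _ _ _ _ hss hSel hTam => fineMuZeroAt_of_door hDoor W hss hSel hTam

end Summit.BirchSwinnertonDyer.BirchSwinnertonDyer.Cruxes.SupersingularRankZeroAtTwo.D93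

end
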